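import Summits.Parity.GeneralizedHardyLittlewood.Theses.MaynardProductExact
import Literature.NumberTheory.Sieve.PolymathProductHoeffdingBounds
import Literature.NumberTheory.Sieve.PolymathProductLatticeBounds
import HarnessLib

/-!
# BC3 birth skeleton — crux `NumLB3749` (rank 2) of route `MaynardProductExact`
(Parity / GeneralizedHardyLittlewood; item stmt-Parity-19245) — HOEFFDING-RECENTRED kernel-certificate form

Line-writer seat `linewriter-parity-certcluster-1` g0, 2026-08-31.  Supersedes the pre-open birth skeleton
`pub/parity-ideate/parity-ideate-p3/route4/bc/NumLB3749_birth.lean` (sha16 5ab10a2a0cf2a9df, plain floor coupling with a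
local crux `def`) and the numerator half of `KernelCert_v5.lean` (62efce5af78542e6): the tree has since LANDED the
Hoeffding-recentred numerator sandwich `Literature.NumberTheory.Sieve.MaynardTao.sum_weight_dconvPow_le_setIntegral_cpow_hoeffding`
(file `PolymathProductHoeffding`), the weight/profile data `setIntegral_Ioc_polymathProfile` (exact primitive
`∫_{(0,x]} g = log((c+3749·min(max x 0, 3/4))/c)/3749`), `setIntegral_Ici_polymathProfile_sq`,
`setIntegral_roundErr_mul_eq`, `setIntegral_Ici_id_mul_polymathProfile_sq`, `cellMass_polymathProfile_sq`, the log
enclosure table `KernelLog.logIv` / midpoint bounds `PolymathProfileMidpointBounds`, the exact-integer layer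
`ConvolutionPowerIntegerArithmetic`, and the complete `k = 4500` template `MaynardProductKernelCert4500`
(`FactA`: `T ≤ Σ_m w_m conv_m(P)` by `decide +kernel`).  This line states the `k = 3750` NUMERATOR obligation in that shape.

LINE.  `NumLB3749` (`19076·10⁻¹⁰ · m₂^{3749} ≤ N = ∫_{(0,1]} (∫₀^{1−w} g)² (g²)^{⋆3749}(w) dw`,
`g = polymathProfile 3750 (249/2000) (3/4)`, `m₂ = 10⁶/466771167 = ∫ g²` exactly)  ⇐  `stub_numHoeffdingCert`: on SOME
lattice `h > 0` (`J_c h > 3/4`) with a window `M`, a shift `δ` and a tail parameter `λ ≥ 0` satisfying the recentring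
side condition `δ + λ ≤ 3749·(h − e)` (`e = (∫ r_h g²)/m₂`, explicit by `roundErr_moment_eq` below), the FINITE inequality
`19076·10⁻¹⁰·m₂^{3749} ≤ Σ_{m<M} W((m+3749)h − δ)·(p^{∗3749})_m − W∞ · m₂^{3749} e^{−2λ²/(3749 h²)}` holds, where
`W(y) = (∫_{(0,1−y]} g)²` (exact logs — the hand lower-bounds them by `KernelLog.logIv` rationals, legitimate since
`(p^{∗3749})_m ≥ 0`), `W∞ = (∫_{(0,3/4]} g)² = (log(5623749/249)/3749)²`, `p_j = cellMass g² h j` (exact rationals).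
Composition `NumLB3749_of` = one application of `sum_weight_dconvPow_le_setIntegral_cpow_hoeffding` with the antitone
weight `Ψ(w) = (∫_{(0,1−w]} g)²` (PROVED below, pattern of `maynardFunctional_productTestFn_ge_hoeffdingRatio`).  The stub
is STRICTLY STRONGER than the crux (a specific finite sufficient condition; cell numerics: `N·3750/D = 3.00353`, target
needs `N ≥ 19076·10⁻¹⁰ m₂^{3749}` against the true `≈ 19094·10⁻¹⁰ m₂^{3749}` — relative slack ≈ `9·10⁻⁴`, kit j247320 /
j249077) — not a restatement.  Size guide (writer's estimate, not certified): same lattice as the denominator line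
(`h ≈ 1/(1–2.5·10⁶)`, `Λ = λ/h ≈ 350–500`), window `M ≈ (1 − 0.25)/h` cells below the recentred mean; ONE convolution power
`p^{∗3749}` serves this stub and `p^{∗3750} = p ∗ p^{∗3749}` serves `DenUB3750` — build both facts from one chain.
Proof class: ccert / kernel (`decide +kernel`); the LINE is kit 0.
-/

noncomputable section

open MeasureTheory Set Finset
open Literature.Analysis.Convolution Literature.NumberTheory.Sieve Literature.NumberTheory.Sieve.MaynardTao

namespace Summit.Parity.GeneralizedHardyLittlewood.Cruxes.NumLB3749.Birth

/-- Polymath's profile `g = 1_{[0,3/4]}/(249/2000 + 3749 t)` (`k = 3750`). -/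
def g : ℝ → ℝ := polymathProfile 3750 ((249 : ℝ) / 2000) ((3 : ℝ) / 4)
/-- `φ = g²`, the one-factor density. -/
def φ : ℝ → ℝ := fun t => polymathProfile 3750 ((249 : ℝ) / 2000) ((3 : ℝ) / 4) t ^ 2

theorem g_locBdd : LocBdd g := locBdd_polymathProfile (k := 3750) (by norm_num) (by norm_num) (by norm_num)

theorem g_nonneg : ∀ t, 0 ≤ g t := by
  intro t
  by_cases ht : t ∈ Icc (0:ℝ) ((3 : ℝ) / 4)
  · have h1 := (polymathProfile_mem_Icc (k := 3750) (by norm_num) (by norm_num : (0:ℝ) < 249 / 2000)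
      (by norm_num) ht).1
    refine le_trans (one_div_pos.2 ?_).le h1
    have := ht.2; push_cast; nlinarith [ht.1, ht.2]
  · simp [g, polymathProfile_of_notMem ht]

theorem g_eq_zero_of_gt : ∀ x, (3 : ℝ) / 4 < x → g x = 0 :=
  fun x hx => polymathProfile_of_notMem fun h' => (not_lt.2 h'.2) hx

theorem φ_locBdd : LocBdd φ := by
  have : φ = fun t => g t * g t := by funext t; simp [φ, g, sq]
  rw [this]; exact g_locBdd.mul g_locBdd

theorem φ_nonneg : ∀ t, 0 ≤ φ t := fun t => sq_nonneg _

theorem φ_eq_zero_of_gt : ∀ x, (3 : ℝ) / 4 < x → φ x = 0 := fun x hx => by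
  simp only [φ]; rw [show polymathProfile 3750 ((249 : ℝ) / 2000) ((3 : ℝ) / 4) x = g x from rfl,
    g_eq_zero_of_gt x hx]; ring

/-- `m₂ = ∫_{[0,∞)} g² = 10⁶/466771167` EXACTLY (PROVED, `setIntegral_Ici_polymathProfile_sq`). -/
theorem mass_eq : (1000000 : ℝ) / 466771167 = ∫ x in Ici 0, φ x := by
  simp only [φ]
  rw [setIntegral_Ici_polymathProfile_sq (k := 3750) (by norm_num) (by norm_num) (by norm_num)]
  norm_num

/-- **Mean rounding error of one factor, explicit** (PROVED): for `h > 0`, `J_c h > 3/4`,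
`∫_{[0,∞)} r_h φ = (log(5623749/249) − 5623500/5623749)/3749² − h Σ_{j<J_c} j p_j`. -/
theorem roundErr_moment_eq {h : ℝ} (hh : 0 < h) {Jc : ℕ} (hJc : (3 : ℝ) / 4 < (Jc : ℝ) * h) :
    ∫ x in Ici 0, roundErr h x * φ x =
      1 / (3749 : ℝ) ^ 2 * (Real.log ((5623749 : ℝ) / 249) - (5623500 : ℝ) / 5623749) -
        h * ∑ j ∈ range Jc, (j : ℝ) * cellMass φ h j := by
  rw [setIntegral_roundErr_mul_eq φ_locBdd φ_eq_zero_of_gt hh hJc]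
  simp only [φ]
  rw [setIntegral_Ici_id_mul_polymathProfile_sq (k := 3750) (by norm_num) (by norm_num) (by norm_num)]
  norm_num

/-- **The weights, explicit** (PROVED, `setIntegral_Ioc_polymathProfile`): `∫_{(0,x]} g = log((249/2000 + 3749·min(max x 0)(3/4))/(249/2000))/3749`. -/
theorem weight_eq (x : ℝ) :
    ∫ u in Ioc 0 x, g u =
      1 / (3749 : ℝ) * Real.log (((249 : ℝ) / 2000 + 3749 * min (max x 0) ((3 : ℝ) / 4)) / ((249 : ℝ) / 2000)) := by
  simp only [g]
  rw [setIntegral_Ioc_polymathProfile (k := 3750) (by norm_num) (by norm_num) (by norm_num)]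
  norm_num

/-- Stub statement (the Hoeffding-recentred NUMERATOR lattice certificate), `g`, `φ` unfolded. -/
def Signature.stub_numHoeffdingCert : Prop :=
  ∃ (h : ℝ) (Jc M : ℕ) (δ lam : ℝ), 0 < h ∧ (3 : ℝ) / 4 < (Jc : ℝ) * h ∧ 0 ≤ lam ∧
    δ + lam ≤ (3749 : ℝ) * (h -
      (∫ x in Ici 0, roundErr h x * polymathProfile 3750 ((249 : ℝ) / 2000) ((3 : ℝ) / 4) x ^ 2) /
        ((1000000 : ℝ) / 466771167)) ∧
    (19076 : ℝ) / 10000000000 * ((1000000 : ℝ) / 466771167) ^ 3749 ≤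
      ∑ m ∈ range M,
          (∫ u in Ioc 0 (1 - ((((m + 3749 : ℕ) : ℝ)) * h - δ)),
              polymathProfile 3750 ((249 : ℝ) / 2000) ((3 : ℝ) / 4) u) ^ 2 *
            dconvPow (cellMass (fun t => polymathProfile 3750 ((249 : ℝ) / 2000) ((3 : ℝ) / 4) t ^ 2) h) 3749 m -
        (∫ u in Ioc 0 ((3 : ℝ) / 4), polymathProfile 3750 ((249 : ℝ) / 2000) ((3 : ℝ) / 4) u) ^ 2 *
          (((1000000 : ℝ) / 466771167) ^ 3749 * Real.exp (-2 * lam ^ 2 / ((3749 : ℝ) * h ^ 2)))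

/-- **The open stub** (XL, kernel-certificate class): statement SPELLED OUT (definitionally
`Signature.stub_numHoeffdingCert`, see the `example` below).  Some lattice `h > 0`, `J_c h > 3/4`, window `M`, shift `δ`,
`λ ≥ 0` with the recentring side condition `δ + λ ≤ 3749·(h − (∫ r_h g²)/m₂)` and
`19076·10⁻¹⁰·m₂^{3749} ≤ Σ_{m<M} (∫_{(0,1−((m+3749)h−δ)]} g)² (p^{∗3749})_m − (∫_{(0,3/4]} g)² · m₂^{3749} e^{−2λ²/(3749 h²)}`,
`p = cellMass g² h`, `m₂ = 10⁶/466771167`. -/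
theorem stub_numHoeffdingCert :
    ∃ (h : ℝ) (Jc M : ℕ) (δ lam : ℝ), 0 < h ∧ (3 : ℝ) / 4 < (Jc : ℝ) * h ∧ 0 ≤ lam ∧
      δ + lam ≤ (3749 : ℝ) * (h -
        (∫ x in Ici 0, roundErr h x * polymathProfile 3750 ((249 : ℝ) / 2000) ((3 : ℝ) / 4) x ^ 2) /
          ((1000000 : ℝ) / 466771167)) ∧
      (19076 : ℝ) / 10000000000 * ((1000000 : ℝ) / 466771167) ^ 3749 ≤
        ∑ m ∈ range M,
            (∫ u in Ioc 0 (1 - ((((m + 3749 : ℕ) : ℝ)) * h - δ)),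
                polymathProfile 3750 ((249 : ℝ) / 2000) ((3 : ℝ) / 4) u) ^ 2 *
              dconvPow (cellMass (fun t => polymathProfile 3750 ((249 : ℝ) / 2000) ((3 : ℝ) / 4) t ^ 2) h) 3749 m -
          (∫ u in Ioc 0 ((3 : ℝ) / 4), polymathProfile 3750 ((249 : ℝ) / 2000) ((3 : ℝ) / 4) u) ^ 2 *
            (((1000000 : ℝ) / 466771167) ^ 3749 * Real.exp (-2 * lam ^ 2 / ((3749 : ℝ) * h ^ 2))) := by
  sorry

example : Signature.stub_numHoeffdingCert := stub_numHoeffdingCert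

/-- **Composition (kernel-checked)**: the stub gives the ROUTE crux BY NAME, through the landed Hoeffding-recentred
numerator sandwich `sum_weight_dconvPow_le_setIntegral_cpow_hoeffding` with the antitone weight `Ψ(w) = (∫_{(0,1−w]} g)²`. -/
theorem NumLB3749_of :
    Signature.stub_numHoeffdingCert →
      Summit.Parity.GeneralizedHardyLittlewood.Theses.MaynardProductExact.NumLB3749 := by
  rintro ⟨h, Jc, M, δ, lam, hh, hJc, hlam, hcond, hsum⟩
  have hm₀pos : (0 : ℝ) < (1000000 : ℝ) / 466771167 := by norm_num
  -- the weight `Ψ(w) = (∫_{(0,1−w]} g)²`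
  set G : ℝ → ℝ := fun y => ∫ u in Ioc 0 y, g u with hGdef
  set Ψ : ℝ → ℝ := fun w => G (1 - w) ^ 2 with hΨdef
  have hG0 : ∀ y, 0 ≤ G y := fun y => setIntegral_nonneg measurableSet_Ioc fun u _ => g_nonneg u
  have hGmono : Monotone G := by
    intro a b hab
    exact setIntegral_mono_set (g_locBdd.integrableOn_Ioc _ _)
      (Filter.Eventually.of_forall fun u => g_nonneg u)
      (Filter.Eventually.of_forall (Ioc_subset_Ioc_right hab))
  have hΨ : Antitone Ψ := by
    intro a b hab
    simp only [hΨdef]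
    exact pow_le_pow_left₀ (hG0 _) (hGmono (by linarith)) 2
  have hΨ0 : ∀ x, 0 ≤ Ψ x := fun x => sq_nonneg _
  have hΨ1 : Ψ 1 = 0 := by simp [hΨdef, hGdef]
  have hΨB : ∀ x, Ψ x ≤ (∫ u in Ioc 0 ((3 : ℝ) / 4), g u) ^ 2 := fun x =>
    pow_le_pow_left₀ (hG0 _)
      (setIntegral_Ioc_le_setIntegral_Ioc_of_support g_locBdd g_nonneg g_eq_zero_of_gt (by norm_num) _) 2
  have hcond' : δ + lam ≤
      ((3748 : ℕ) + 1 : ℝ) * (h - (∫ x in Ici 0, roundErr h x * φ x) / ((1000000 : ℝ) / 466771167)) := by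
    have e : ((3748 : ℕ) + 1 : ℝ) = (3749 : ℝ) := by norm_num
    rw [e]; exact hcond
  have main := sum_weight_dconvPow_le_setIntegral_cpow_hoeffding φ_locBdd φ_nonneg φ_eq_zero_of_gt hh hJc 3748
    hΨ hΨ0 hΨB hΨ1 M δ hlam mass_eq hm₀pos hcond'
  have e1 : (3748 + 1 : ℕ) = 3749 := rfl
  have e2 : ((3748 : ℕ) + 1 : ℝ) = (3749 : ℝ) := by norm_num
  have hR : ∫ w in Ioc 0 1, Ψ w * cpow φ (3748 + 1) w =
      ∫ w in Ioc (0 : ℝ) 1, (∫ u in (0 : ℝ)..(1 - w), polymathProfile 3750 ((249 : ℝ) / 2000) ((3 : ℝ) / 4) u) ^ 2 *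
        cpow (fun t => polymathProfile 3750 ((249 : ℝ) / 2000) ((3 : ℝ) / 4) t ^ 2) 3749 w := by
    refine setIntegral_congr_fun measurableSet_Ioc fun w hw => ?_
    simp only [hΨdef, hGdef, g, e1]
    rw [intervalIntegral.integral_of_le (by linarith [hw.2])]
    rfl
  rw [hR] at main
  simp only [hΨdef, hGdef, g, e1, e2] at main
  exact hsum.trans main

/-- **The skeleton instantiated**: the crux BY NAME modulo the single registered stub (carries exactly its `sorry`). -/
theorem NumLB3749_of_stubs :
    Summit.Parity.GeneralizedHardyLittlewood.Theses.MaynardProductExact.NumLB3749 :=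
  NumLB3749_of stub_numHoeffdingCert

end Summit.Parity.GeneralizedHardyLittlewood.Cruxes.NumLB3749.Birth

end
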